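/-
Origin: expansion seat `planner-pub-hodgecm-mc-axioms-1-g14-0`, handover #W111 2026-08-20T15:53:55Z md5 895d559a594f (PKG 8995a9f87469 → 895d559a594f; 282 l.; MECHANICAL (iib-R) rewrite v3.1 of the PKG file as it stands (313 token edits; rules R1x1+R5x1+RX[h₂]x311)) (`HOME/mc/pub-hodgecm-mc-axioms-1-g14/revendor/kit-r55/stage55/HodgeCM/Model/E2InstanceR8.lean`, md5 895d559a594f, 282 lines);
landed by the gen-22 packager (p-g22) in gate run 55 REPLACES the earlier landed copy of `HodgeCM/Model/E2InstanceR8.lean` (seat copy carried the packager Origin header of an earlier run (stripped)).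
-/
/-
Origin: CONSTRUCTION seat `planner-pub-hodgecm-mc-glue-1-g6-0` (unit pub-hodgecm-mc-glue-1-g6, gen 6 of mc-glue-1, node E ASSEMBLER), 2026-08-19T18:00Z — revision (§60) of `HodgeCM/Model/E2InstanceR8.lean` for RUN 37: the (Θ-sat-≤) ORDER CASCADE (BINDER-TRIAGE §60: theta saturation in the `K`-order `Γ' ≤ Γ :↔ Γ'.K ≤ Γ.K` of the (W1) `Level`-pair root, covers `cover Γ Γ' (Level.Γ_mono h)`), forced by the K-order `Model.thetaSatOf` (theta-3-g9 t37 #C2); kit `mc/pub-hodgecm-mc-glue-1-g6/t37c-mcglue1g6.txt`; base PKG (RUN-35 bytes, glue-1 lineage). REPLACE — binder `thetaSat` re-typed to the K-order at its 3 occurrences (core / pinned / instance), as R6. Kernel only: 0 `proof-hole`, 0 new declarations, cites nothing new; expected `#print axioms` unchanged (⊆ {propext, Classical.choice, Quot.sound}).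
-/
/-
Origin: expansion seat `planner-pub-hodgecm-mc-glue-1-g4-0`, handover #305 2026-08-19T00:54Z md5 4767d29ddd19d3681182f8730c156eac (NEW PKG leaf, 271 l.; farm run33k rc 0 / 0 warnings, axioms trio; node E END STATE revision 8: @[reducible] def Model.linOfInput W := fun V c => linearStr_wmOf' printFact_unitaryCompact_holds (W V c) (binder lin PRODUCED, unitary-1-g3 rev-c); theorem Model.thetaSub_of_fact (= R6 thetaSub_of_hLiu over a PARAMETER h31 : U.Fact_cmInflation) (`HOME/mc/pub-hodgecm-mc-glue-1-g4/lean/E2InstanceR8.lean`, md5 4767d29d, 271 lines);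
landed by the gen-9 packager (p-g9) in gate run 33 as `HodgeCM/Model/E2InstanceR8.lean` (verbatim).
-/
/-
Origin: CONSTRUCTION seat `planner-pub-hodgecm-mc-glue-1-g4-0` (unit pub-hodgecm-mc-glue-1-g4, gen 4 of mc-glue-1,
node E ASSEMBLER), 2026-08-19.  NEW additive leaf `HodgeCM/Model/E2InstanceR8.lean`.  Imports: `E2InstanceR7`
(revision 7 and everything below it: `Model.wmOfInput`, mc-unitary-1-g3's `Model.wmOf'` / `Model.linearStr_wmOf'`
(`WmInstance` rev-c), mc-theta-3-g3's `Model.thetaClassInputOf` / `Model.classPacksOf_thetaModelOf`) and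
`CMInflationRiemann` (mc-axioms-1-g4, node D3-geom (v5) rev 3: `Model.fact_cmInflation_riemann`).
No proof holes; every undischarged input is an explicit binder.  Expected `#print axioms`:
{propext, Classical.choice, Quot.sound}.
-/
import Summits.HodgeConjecture.HodgeCM.Model.E2InstanceR7
import Summits.HodgeConjecture.HodgeCM.Model.CMInflationRiemann

/-!
# E2 instance, revision 8: `lin` PRODUCED, `h31` (CM inflation) made a PARAMETER with two PRINT instances

Three theorems of the end-state type `(picardCMUniverse hHD hI h₁ h₃).PerL` at the revision-7 theta model
`T := thetaModelOf hHD hI h₁ h₃ h (embOf …) (coverOf … hA) (wmOfInput W) (thetaOf _ (thetaClassInputOf _ X)) (d12Of μ)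
(d34Of μ)`:

* `Model.perL_picardCM_r8core` — revision 7 with (1) the binder `lin V c : (wmOfInput W V c).LinearStr` (linear
  structure of the Weil–theta model) REPLACED by mc-unitary-1-g3's kernel instance `Model.linearStr_wmOf'`
  (`WmInstance.lean` rev-c: the Schwartz–Bruhat space is a `ℂ`-submodule, `ρ(p)` and `Θ` are linear — `map_add` /
  `map_smul` — and `𝒮^κ` is a linear subspace by the three `WmInput` fields `SK_zero/SK_add/SK_smul`), packaged as
  the family `Model.linOfInput W`; and (2) the two PRINT binders `hd : Shimura1998_Thm3_isogenousPower`,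
  `ha : Shimura1998_Thm2_Cor` — consumed in revisions 2–7 only through `Model.fact_cmInflation_printed … hd ha :
  U.Fact_cmInflation` inside `Model.thetaSub_of_hLiu` — REPLACED by the single parameter
  `h31 : (picardCMUniverse hHD hI h₁ h₃).Fact_cmInflation` (the universe's M38 statement itself, a HYPOTHESIS of
  this core theorem, never asserted).  Proof: the bottom theorem `Model.perL_picardCM` (revision 1) composed with the
  producers of revisions 2–7 exactly as `Model.perL_picardCM_r6` composes them, with `Model.thetaSub_of_fact` (below)
  in place of `Model.thetaSub_of_hLiu`; nothing is re-proved.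
* `Model.perL_picardCM_r8` — the core at `h31 := Model.fact_cmInflation_riemann hHD hI h₃ h₁ hR`
  (mc-axioms-1-g4, `CMInflationRiemann.lean`: M38 from Riemann's theorem in the Deligne–Milne form), binder
  `hR : DeligneMilne1982_Thm_6_20_full` (PRINT: Deligne–Milne 1982, LNM 900, Thm. 6.20, fullness conjunct; tree record
  `Literature/AlgebraicGeometry/HodgeTheory/AbelianVarietyHodgeFullnessRecord.lean`).  Binders (16): `hHR`, `h`, `hA`,
  `W`, `X`, `μ`, `hBetti`, `hR`, `hLiu`, `thetaSat`, `transl`, `A`, `gen12`, `real34`, `hyp12`, `hyp34`.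
* `Model.perL_picardCM_r8s` — the core at `h31 := Model.fact_cmInflation_printed hHD hI h₃ h₁ hd ha` (mc-axioms-1-g3,
  `CMInflationPrinted.lean`, revision 5's route), binders `hd`, `ha` as in revision 7 minus `lin`.  Which of `_r8` /
  `_r8s` is the headline is a print-ledger (MODEL-N) choice, not a kernel one; both are one-line instances of the core.
-/

noncomputable section

open scoped TensorProduct InnerProductSpace Matrix

namespace HodgeCM

namespace Model

open HodgeCM.Universe (AdelicThetaCore AdelicThetaCore₀ SideData ThetaModel ModelAxiomsPerL)
open Literature.AlgebraicGeometry.HodgeTheory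
open Literature.AlgebraicGeometry.ComplexMultiplication (Shimura1998_Thm3_isogenousPower Shimura1998_Thm2_Cor)
open Literature.NumberTheory.Automorphic.PicardCM
open Literature.NumberTheory.Transcendental (Arapura2012_Cor_15_4_6)
open HodgeCM.CMTypeOps (inflate)
open HodgeCM.Model.SupplyInstance (LineSupplyData)
open HodgeCM.Model.SupplyResidual (ClassSupplyPackN)

variable (hHD : exists_isReal_hodgeModel) (hI : hodgePQ_independent_of_hodgeModel)
  (h₁ : BallQuotientUniformised)  (h₃ : CMAbelianVarietyRealised)

/-- **The linear structure of the end-state Weil–theta models, PRODUCED** (binder `lin` of revisions 1–7):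
`linOfInput W V c := Model.linearStr_wmOf' printFact_unitaryCompact_holds (W V c)` — mc-unitary-1-g3's instance
(`WmInstance.lean` rev-c), as a family of the exact type of the old binder (`wmOfInput W V c` unfolds to
`wmOf' _ (W V c)` by `rfl`); `@[reducible]` as Lean requires for a definition of class type. -/
@[reducible] def linOfInput (W : ∀ {L : CMField} {ι₁ : L →+* ℂ} (V : HermSpace3 L ι₁) (c : SeesawCtx L), WmInput V c.D) :
    ∀ {L : CMField} {ι₁ : L →+* ℂ} (V : HermSpace3 L ι₁) (c : SeesawCtx L), (wmOfInput W V c).LinearStr :=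
  fun V c => linearStr_wmOf' printFact_unitaryCompact_holds (W V c)

/-- (Ported verbatim from the HodgeCMPerL package; no docstring in the source.) -/
theorem linOfInput_apply (W : ∀ {L : CMField} {ι₁ : L →+* ℂ} (V : HermSpace3 L ι₁) (c : SeesawCtx L), WmInput V c.D)
    {L : CMField} {ι₁ : L →+* ℂ} (V : HermSpace3 L ι₁) (c : SeesawCtx L) :
    linOfInput W V c = linearStr_wmOf' printFact_unitaryCompact_holds (W V c) := rfl

/-- **Theta ⊆ isotypic at good sextic contexts from `hLiu` and a CM-inflation statement `h31`** — revision 6's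
`Model.thetaSub_of_hLiu` with `Model.fact_cmInflation_printed … hd ha` replaced by the PARAMETER
`h31 : U.Fact_cmInflation` (same six-line proof: `Universe.Uiso_inflate_le` over `pull_comp`, `fact_alphaLine`, `h31`). -/
theorem thetaSub_of_fact (h : Bool) (hA : Arapura2012_Cor_15_4_6)
    (W : ∀ {L : CMField} {ι₁ : L →+* ℂ} (V : HermSpace3 L ι₁) (c : SeesawCtx L), WmInput V c.D)
    (X : ∀ {L : CMField} {ι₁ : L →+* ℂ} (V : HermSpace3 L ι₁) (c : SeesawCtx L),
      ThetaSpaceInput (picardCMUniverse hHD hI h₁ h₃) V c)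
    (μ : ∀ {L : CMField}, SeesawCtx L → Fin 4 → NumberField.InfinitePlace L → ℤ)
    (h31 : (picardCMUniverse hHD hI h₁ h₃).Fact_cmInflation)
    (hLiu : ∀ {L : CMField} {ι₁ : L →+* ℂ} (V : HermSpace3 L ι₁) (c : SeesawCtx L),
      (thetaModelOf hHD hI h₁ h₃ h (embOf hHD hI h₁ h₃) (coverOf hHD hI h₁ h₃ hA) (wmOfInput W) (thetaOf _ (thetaClassInputOf _ X)) (d12Of μ) (d34Of μ)).GoodCtx ι₁ c → Module.finrank ℚ c.K = 6 →
      ∀ (i : Fin 4) (Γ : Level V), ∃ (M : CMField) (k : c.K →+* M) (σ' : M →+* ℂ), σ'.comp k = c.σ ∧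
        (thetaModelOf hHD hI h₁ h₃ h (embOf hHD hI h₁ h₃) (coverOf hHD hI h₁ h₃ hA) (wmOfInput W) (thetaOf _ (thetaClassInputOf _ X)) (d12Of μ) (d34Of μ)).Theta V c i Γ ⊆
          (picardCMUniverse hHD hI h₁ h₃).Uiso Γ M (inflate k (c.Ψ i)) σ')
    {L : CMField} {ι₁ : L →+* ℂ} (V : HermSpace3 L ι₁) (c : SeesawCtx L)
    (hc : (thetaModelOf hHD hI h₁ h₃ h (embOf hHD hI h₁ h₃) (coverOf hHD hI h₁ h₃ hA) (wmOfInput W) (thetaOf _ (thetaClassInputOf _ X)) (d12Of μ) (d34Of μ)).GoodCtx ι₁ c) (hK : Module.finrank ℚ c.K = 6) (i : Fin 4) (Γ : Level V) :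
    (thetaModelOf hHD hI h₁ h₃ h (embOf hHD hI h₁ h₃) (coverOf hHD hI h₁ h₃ hA) (wmOfInput W) (thetaOf _ (thetaClassInputOf _ X)) (d12Of μ) (d34Of μ)).Theta V c i Γ ⊆
      (picardCMUniverse hHD hI h₁ h₃).Uiso Γ c.K (c.Ψ i) c.σ := by
  intro ω hω
  obtain ⟨M, k, σ', hσ, hsub⟩ := hLiu V c hc hK i Γ
  have hle := Universe.Uiso_inflate_le (Model.modelAxiomsPerL hHD hI h₃ h₁).pull_comp
    (Model.fact_alphaLine (hHD := hHD) (hI := hI) (h₁ := h₁) (h₃ := h₃))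
    h31 Γ c.K M k (c.Ψ i) σ' (hsub hω)
  rw [hσ] at hle
  exact hle

/-- **E2 instance, revision 8 — CORE over a CM-inflation parameter `h31`** (see the module docstring). -/
theorem perL_picardCM_r8core (hHR : BettiUniverse.HodgeRiemann20) (h : Bool)
    (hA : Arapura2012_Cor_15_4_6)
    (W : ∀ {L : CMField} {ι₁ : L →+* ℂ} (V : HermSpace3 L ι₁) (c : SeesawCtx L), WmInput V c.D)
    (X : ∀ {L : CMField} {ι₁ : L →+* ℂ} (V : HermSpace3 L ι₁) (c : SeesawCtx L),
      ThetaSpaceInput (picardCMUniverse hHD hI h₁ h₃) V c)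
    (μ : ∀ {L : CMField}, SeesawCtx L → Fin 4 → NumberField.InfinitePlace L → ℤ)
    (hBetti : ∀ {L : CMField} {ι₁ : L →+* ℂ} (V : HermSpace3 L ι₁), EmbBettiSide hHD hI h₁ h₃ V)
    (h31 : (picardCMUniverse hHD hI h₁ h₃).Fact_cmInflation)
    (hLiu : ∀ {L : CMField} {ι₁ : L →+* ℂ} (V : HermSpace3 L ι₁) (c : SeesawCtx L),
      (thetaModelOf hHD hI h₁ h₃ h (embOf hHD hI h₁ h₃) (coverOf hHD hI h₁ h₃ hA) (wmOfInput W) (thetaOf _ (thetaClassInputOf _ X)) (d12Of μ) (d34Of μ)).GoodCtx ι₁ c → Module.finrank ℚ c.K = 6 →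
      ∀ (i : Fin 4) (Γ : Level V), ∃ (M : CMField) (k : c.K →+* M) (σ' : M →+* ℂ), σ'.comp k = c.σ ∧
        (thetaModelOf hHD hI h₁ h₃ h (embOf hHD hI h₁ h₃) (coverOf hHD hI h₁ h₃ hA) (wmOfInput W) (thetaOf _ (thetaClassInputOf _ X)) (d12Of μ) (d34Of μ)).Theta V c i Γ ⊆
          (picardCMUniverse hHD hI h₁ h₃).Uiso Γ M (inflate k (c.Ψ i)) σ')
    (thetaSat : ∀ {L : CMField} {ι₁ : L →+* ℂ} (V : HermSpace3 L ι₁) (c : SeesawCtx L)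
      (i : Fin 4) (Γ Γ' : Level V) (hle : Γ' ≤ Γ) (ω : (picardCMUniverse hHD hI h₁ h₃).CohC ((picardCMUniverse hHD hI h₁ h₃).pms L ι₁ V Γ) 1),
      ω ∈ (thetaModelOf hHD hI h₁ h₃ h (embOf hHD hI h₁ h₃) (coverOf hHD hI h₁ h₃ hA) (wmOfInput W) (thetaOf _ (thetaClassInputOf _ X)) (d12Of μ) (d34Of μ)).Theta V c i Γ →
        (picardCMUniverse hHD hI h₁ h₃).pullC (coverOf hHD hI h₁ h₃ hA Γ Γ' (Level.Γ_mono hle)) 1 ω ∈ (thetaModelOf hHD hI h₁ h₃ h (embOf hHD hI h₁ h₃) (coverOf hHD hI h₁ h₃ hA) (wmOfInput W) (thetaOf _ (thetaClassInputOf _ X)) (d12Of μ) (d34Of μ)).Theta V c i Γ')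
    (transl : ∀ {L : CMField} {ι₁ : L →+* ℂ} (V : HermSpace3 L ι₁) (c : SeesawCtx L)
      (hc : (thetaModelOf hHD hI h₁ h₃ h (embOf hHD hI h₁ h₃) (coverOf hHD hI h₁ h₃ hA) (wmOfInput W) (thetaOf _ (thetaClassInputOf _ X)) (d12Of μ) (d34Of μ)).GoodCtx ι₁ c) (hK : Module.finrank ℚ c.K = 6),
      ∀ γ ∈ (ballOf hHD hI h₁ h₃ V c (two_lt_finrank_of_goodCtx hHD hI h₁ h₃ hc hK)).Δ, ∀ (i : Fin 4) (Γ : Level V) (ω : (picardCMUniverse hHD hI h₁ h₃).CohC ((picardCMUniverse hHD hI h₁ h₃).pms L ι₁ V Γ) 1),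
      ω ∈ (thetaModelOf hHD hI h₁ h₃ h (embOf hHD hI h₁ h₃) (coverOf hHD hI h₁ h₃ hA) (wmOfInput W) (thetaOf _ (thetaClassInputOf _ X)) (d12Of μ) (d34Of μ)).Theta V c i Γ → ∃ (Γ' : Level V) (ω' : (picardCMUniverse hHD hI h₁ h₃).CohC ((picardCMUniverse hHD hI h₁ h₃).pms L ι₁ V Γ') 1),
        ω' ∈ (thetaModelOf hHD hI h₁ h₃ h (embOf hHD hI h₁ h₃) (coverOf hHD hI h₁ h₃ hA) (wmOfInput W) (thetaOf _ (thetaClassInputOf _ X)) (d12Of μ) (d34Of μ)).Theta V c i Γ' ∧ (ballOf hHD hI h₁ h₃ V c (two_lt_finrank_of_goodCtx hHD hI h₁ h₃ hc hK)).ev Γ' ω' =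
          fun x => (ballOf hHD hI h₁ h₃ V c (two_lt_finrank_of_goodCtx hHD hI h₁ h₃ hc hK)).J γ x *ᵥ (ballOf hHD hI h₁ h₃ V c (two_lt_finrank_of_goodCtx hHD hI h₁ h₃ hc hK)).ev Γ ω (γ • x))
    (A : ∀ {L : CMField} {ι₁ : L →+* ℂ} (V : HermSpace3 L ι₁) (c : SeesawCtx L),
      (thetaModelOf hHD hI h₁ h₃ h (embOf hHD hI h₁ h₃) (coverOf hHD hI h₁ h₃ hA) (wmOfInput W) (thetaOf _ (thetaClassInputOf _ X)) (d12Of μ) (d34Of μ)).GoodCtx ι₁ c → Module.finrank ℚ c.K = 6 →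
        ∀ k : Fin 4, k = 0 ∨ k = 1 → ∀ N : ℕ, 0 < N → SupplySituationAt (X V c) k N)
    (gen12 : ∀ {L : CMField} {ι₁ : L →+* ℂ} (V : HermSpace3 L ι₁) (c : SeesawCtx L),
      (thetaModelOf hHD hI h₁ h₃ h (embOf hHD hI h₁ h₃) (coverOf hHD hI h₁ h₃ hA) (wmOfInput W) (thetaOf _ (thetaClassInputOf _ X)) (d12Of μ) (d34Of μ)).GoodCtx ι₁ c → Module.finrank ℚ c.K = 6 →
      Nonempty ((thetaModelOf hHD hI h₁ h₃ h (embOf hHD hI h₁ h₃) (coverOf hHD hI h₁ h₃ hA) (wmOfInput W) (thetaOf _ (thetaClassInputOf _ X)) (d12Of μ) (d34Of μ)).Gen12FunBridge V c))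
    (real34 : ∀ {L : CMField} {ι₁ : L →+* ℂ} (V : HermSpace3 L ι₁) (c : SeesawCtx L),
      (thetaModelOf hHD hI h₁ h₃ h (embOf hHD hI h₁ h₃) (coverOf hHD hI h₁ h₃ hA) (wmOfInput W) (thetaOf _ (thetaClassInputOf _ X)) (d12Of μ) (d34Of μ)).GoodCtx ι₁ c → Module.finrank ℚ c.K = 6 →
      Nonempty ((thetaModelOf hHD hI h₁ h₃ h (embOf hHD hI h₁ h₃) (coverOf hHD hI h₁ h₃ hA) (wmOfInput W) (thetaOf _ (thetaClassInputOf _ X)) (d12Of μ) (d34Of μ)).Real34FunBridge V c))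
    (hyp12 : ∀ {L : CMField} {ι₁ : L →+* ℂ} (V : HermSpace3 L ι₁) (c : SeesawCtx L),
      (thetaModelOf hHD hI h₁ h₃ h (embOf hHD hI h₁ h₃) (coverOf hHD hI h₁ h₃ hA) (wmOfInput W) (thetaOf _ (thetaClassInputOf _ X)) (d12Of μ) (d34Of μ)).GoodCtx ι₁ c → Module.finrank ℚ c.K = 6 →
      Nonempty (((coreOf _ (embOf hHD hI h₁ h₃) (coverOf hHD hI h₁ h₃ hA) (wmOfInput W) (thetaOf _ (thetaClassInputOf _ X))).toCore h).HypSmoothCore12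
        (((coreOf _ (embOf hHD hI h₁ h₃) (coverOf hHD hI h₁ h₃ hA) (wmOfInput W) (thetaOf _ (thetaClassInputOf _ X))).toCore h).side12 (d12Of μ)) (((coreOf _ (embOf hHD hI h₁ h₃) (coverOf hHD hI h₁ h₃ hA) (wmOfInput W) (thetaOf _ (thetaClassInputOf _ X))).toCore h).side34 (d34Of μ))
        ((((coreOf _ (embOf hHD hI h₁ h₃) (coverOf hHD hI h₁ h₃ hA) (wmOfInput W) (thetaOf _ (thetaClassInputOf _ X))).toCore h).analyticKM (((coreOf _ (embOf hHD hI h₁ h₃) (coverOf hHD hI h₁ h₃ hA) (wmOfInput W) (thetaOf _ (thetaClassInputOf _ X))).toCore h).side12 (d12Of μ))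
          (((coreOf _ (embOf hHD hI h₁ h₃) (coverOf hHD hI h₁ h₃ hA) (wmOfInput W) (thetaOf _ (thetaClassInputOf _ X))).toCore h).side34 (d34Of μ))).toAnalytic) V c (ℓ := linOfInput W V c)))
    (hyp34 : ∀ {L : CMField} {ι₁ : L →+* ℂ} (V : HermSpace3 L ι₁) (c : SeesawCtx L),
      (thetaModelOf hHD hI h₁ h₃ h (embOf hHD hI h₁ h₃) (coverOf hHD hI h₁ h₃ hA) (wmOfInput W) (thetaOf _ (thetaClassInputOf _ X)) (d12Of μ) (d34Of μ)).GoodCtx ι₁ c → Module.finrank ℚ c.K = 6 →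
      Nonempty (((coreOf _ (embOf hHD hI h₁ h₃) (coverOf hHD hI h₁ h₃ hA) (wmOfInput W) (thetaOf _ (thetaClassInputOf _ X))).toCore h).HypSmoothCore34
        (((coreOf _ (embOf hHD hI h₁ h₃) (coverOf hHD hI h₁ h₃ hA) (wmOfInput W) (thetaOf _ (thetaClassInputOf _ X))).toCore h).side12 (d12Of μ)) (((coreOf _ (embOf hHD hI h₁ h₃) (coverOf hHD hI h₁ h₃ hA) (wmOfInput W) (thetaOf _ (thetaClassInputOf _ X))).toCore h).side34 (d34Of μ))
        ((((coreOf _ (embOf hHD hI h₁ h₃) (coverOf hHD hI h₁ h₃ hA) (wmOfInput W) (thetaOf _ (thetaClassInputOf _ X))).toCore h).analyticKM (((coreOf _ (embOf hHD hI h₁ h₃) (coverOf hHD hI h₁ h₃ hA) (wmOfInput W) (thetaOf _ (thetaClassInputOf _ X))).toCore h).side12 (d12Of μ))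
          (((coreOf _ (embOf hHD hI h₁ h₃) (coverOf hHD hI h₁ h₃ hA) (wmOfInput W) (thetaOf _ (thetaClassInputOf _ X))).toCore h).side34 (d34Of μ))).toAnalytic) V c (ℓ := linOfInput W V c))) :
    (picardCMUniverse hHD hI h₁ h₃).PerL :=
  perL_picardCM hHD hI h₁ h₃ hHR h (embOf hHD hI h₁ h₃) (coverOf hHD hI h₁ h₃ hA) (wmOfInput W)
    (thetaOf _ (thetaClassInputOf _ X)) (d12Of μ) (d34Of μ)
    (fun V c hc hK => innerEmbAt_of_bettiSide hHD hI h₁ h₃ h (coverOf hHD hI h₁ h₃ hA) (wmOfInput W)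
      (thetaOf _ (thetaClassInputOf _ X)) (d12Of μ) (d34Of μ) V
      ((HermSpace3.isAnisotropic_iff_finrank_ne_two V).2 (two_lt_finrank_of_goodCtx hHD hI h₁ h₃ hc hK).ne')
      (hBetti V))
    (thetaSub_of_fact hHD hI h₁ h₃ h hA W X μ h31 hLiu)
    (fun V c hc hK => (thetaModelOf hHD hI h₁ h₃ h (embOf hHD hI h₁ h₃) (coverOf hHD hI h₁ h₃ hA) (wmOfInput W) (thetaOf _ (thetaClassInputOf _ X)) (d12Of μ) (d34Of μ)).exists_cup_ne_zero_of_ballFacts V c (ballOf hHD hI h₁ h₃ V c (two_lt_finrank_of_goodCtx hHD hI h₁ h₃ hc hK))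
      (ballFactsOf hHD hI h₁ h₃ V c _ (thetaModelOf hHD hI h₁ h₃ h (embOf hHD hI h₁ h₃) (coverOf hHD hI h₁ h₃ hA) (wmOfInput W) (thetaOf _ (thetaClassInputOf _ X)) (d12Of μ) (d34Of μ))
        (thetaSub_of_fact hHD hI h₁ h₃ h hA W X μ h31 hLiu V c hc hK) (thetaSat V c)
        (fun Γ Γ' hle hV v hv => map_coverOf_unif hHD hI h₁ h₃ hA hle hV hv) (transl V c hc hK))
      (by
        obtain ⟨⟨S₀⟩, ⟨S₁⟩⟩ := classPacksOf_thetaModelOf hHD hI h₁ h₃ h (embOf hHD hI h₁ h₃)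
          (coverOf hHD hI h₁ h₃ hA) (wmOfInput W) X (d12Of μ) (d34Of μ) A V c hc hK
        exact ⟨S₀.toPairSupplyData.toLineSupplyData.D.supply S₀.toPairSupplyData.toLineSupplyData.res,
          S₁.toPairSupplyData.toLineSupplyData.D.supply S₁.toPairSupplyData.toLineSupplyData.res⟩))
    gen12 real34
    (occOf hHD hI h₁ h₃ h (embOf hHD hI h₁ h₃) (coverOf hHD hI h₁ h₃ hA) (wmOfInput W)
      (thetaOf _ (thetaClassInputOf _ X)) (d12Of μ) (d34Of μ) (linOfInput W) hyp12 hyp34)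

/-- **E2 instance, revision 8 (Riemann headline)**: the core at
`h31 := Model.fact_cmInflation_riemann hHD hI h₃ h₁ hR` (mc-axioms-1-g4), binder
`hR : DeligneMilne1982_Thm_6_20_full` (Deligne–Milne 1982, Thm. 6.20). -/
theorem perL_picardCM_r8 (hHR : BettiUniverse.HodgeRiemann20) (h : Bool)
    (hA : Arapura2012_Cor_15_4_6)
    (W : ∀ {L : CMField} {ι₁ : L →+* ℂ} (V : HermSpace3 L ι₁) (c : SeesawCtx L), WmInput V c.D)
    (X : ∀ {L : CMField} {ι₁ : L →+* ℂ} (V : HermSpace3 L ι₁) (c : SeesawCtx L),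
      ThetaSpaceInput (picardCMUniverse hHD hI h₁ h₃) V c)
    (μ : ∀ {L : CMField}, SeesawCtx L → Fin 4 → NumberField.InfinitePlace L → ℤ)
    (hBetti : ∀ {L : CMField} {ι₁ : L →+* ℂ} (V : HermSpace3 L ι₁), EmbBettiSide hHD hI h₁ h₃ V)
    (hR : DeligneMilne1982_Thm_6_20_full)
    (hLiu : ∀ {L : CMField} {ι₁ : L →+* ℂ} (V : HermSpace3 L ι₁) (c : SeesawCtx L),
      (thetaModelOf hHD hI h₁ h₃ h (embOf hHD hI h₁ h₃) (coverOf hHD hI h₁ h₃ hA) (wmOfInput W) (thetaOf _ (thetaClassInputOf _ X)) (d12Of μ) (d34Of μ)).GoodCtx ι₁ c → Module.finrank ℚ c.K = 6 →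
      ∀ (i : Fin 4) (Γ : Level V), ∃ (M : CMField) (k : c.K →+* M) (σ' : M →+* ℂ), σ'.comp k = c.σ ∧
        (thetaModelOf hHD hI h₁ h₃ h (embOf hHD hI h₁ h₃) (coverOf hHD hI h₁ h₃ hA) (wmOfInput W) (thetaOf _ (thetaClassInputOf _ X)) (d12Of μ) (d34Of μ)).Theta V c i Γ ⊆
          (picardCMUniverse hHD hI h₁ h₃).Uiso Γ M (inflate k (c.Ψ i)) σ')
    (thetaSat : ∀ {L : CMField} {ι₁ : L →+* ℂ} (V : HermSpace3 L ι₁) (c : SeesawCtx L)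
      (i : Fin 4) (Γ Γ' : Level V) (hle : Γ' ≤ Γ) (ω : (picardCMUniverse hHD hI h₁ h₃).CohC ((picardCMUniverse hHD hI h₁ h₃).pms L ι₁ V Γ) 1),
      ω ∈ (thetaModelOf hHD hI h₁ h₃ h (embOf hHD hI h₁ h₃) (coverOf hHD hI h₁ h₃ hA) (wmOfInput W) (thetaOf _ (thetaClassInputOf _ X)) (d12Of μ) (d34Of μ)).Theta V c i Γ →
        (picardCMUniverse hHD hI h₁ h₃).pullC (coverOf hHD hI h₁ h₃ hA Γ Γ' (Level.Γ_mono hle)) 1 ω ∈ (thetaModelOf hHD hI h₁ h₃ h (embOf hHD hI h₁ h₃) (coverOf hHD hI h₁ h₃ hA) (wmOfInput W) (thetaOf _ (thetaClassInputOf _ X)) (d12Of μ) (d34Of μ)).Theta V c i Γ')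
    (transl : ∀ {L : CMField} {ι₁ : L →+* ℂ} (V : HermSpace3 L ι₁) (c : SeesawCtx L)
      (hc : (thetaModelOf hHD hI h₁ h₃ h (embOf hHD hI h₁ h₃) (coverOf hHD hI h₁ h₃ hA) (wmOfInput W) (thetaOf _ (thetaClassInputOf _ X)) (d12Of μ) (d34Of μ)).GoodCtx ι₁ c) (hK : Module.finrank ℚ c.K = 6),
      ∀ γ ∈ (ballOf hHD hI h₁ h₃ V c (two_lt_finrank_of_goodCtx hHD hI h₁ h₃ hc hK)).Δ, ∀ (i : Fin 4) (Γ : Level V) (ω : (picardCMUniverse hHD hI h₁ h₃).CohC ((picardCMUniverse hHD hI h₁ h₃).pms L ι₁ V Γ) 1),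
      ω ∈ (thetaModelOf hHD hI h₁ h₃ h (embOf hHD hI h₁ h₃) (coverOf hHD hI h₁ h₃ hA) (wmOfInput W) (thetaOf _ (thetaClassInputOf _ X)) (d12Of μ) (d34Of μ)).Theta V c i Γ → ∃ (Γ' : Level V) (ω' : (picardCMUniverse hHD hI h₁ h₃).CohC ((picardCMUniverse hHD hI h₁ h₃).pms L ι₁ V Γ') 1),
        ω' ∈ (thetaModelOf hHD hI h₁ h₃ h (embOf hHD hI h₁ h₃) (coverOf hHD hI h₁ h₃ hA) (wmOfInput W) (thetaOf _ (thetaClassInputOf _ X)) (d12Of μ) (d34Of μ)).Theta V c i Γ' ∧ (ballOf hHD hI h₁ h₃ V c (two_lt_finrank_of_goodCtx hHD hI h₁ h₃ hc hK)).ev Γ' ω' =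
          fun x => (ballOf hHD hI h₁ h₃ V c (two_lt_finrank_of_goodCtx hHD hI h₁ h₃ hc hK)).J γ x *ᵥ (ballOf hHD hI h₁ h₃ V c (two_lt_finrank_of_goodCtx hHD hI h₁ h₃ hc hK)).ev Γ ω (γ • x))
    (A : ∀ {L : CMField} {ι₁ : L →+* ℂ} (V : HermSpace3 L ι₁) (c : SeesawCtx L),
      (thetaModelOf hHD hI h₁ h₃ h (embOf hHD hI h₁ h₃) (coverOf hHD hI h₁ h₃ hA) (wmOfInput W) (thetaOf _ (thetaClassInputOf _ X)) (d12Of μ) (d34Of μ)).GoodCtx ι₁ c → Module.finrank ℚ c.K = 6 →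
        ∀ k : Fin 4, k = 0 ∨ k = 1 → ∀ N : ℕ, 0 < N → SupplySituationAt (X V c) k N)
    (gen12 : ∀ {L : CMField} {ι₁ : L →+* ℂ} (V : HermSpace3 L ι₁) (c : SeesawCtx L),
      (thetaModelOf hHD hI h₁ h₃ h (embOf hHD hI h₁ h₃) (coverOf hHD hI h₁ h₃ hA) (wmOfInput W) (thetaOf _ (thetaClassInputOf _ X)) (d12Of μ) (d34Of μ)).GoodCtx ι₁ c → Module.finrank ℚ c.K = 6 →
      Nonempty ((thetaModelOf hHD hI h₁ h₃ h (embOf hHD hI h₁ h₃) (coverOf hHD hI h₁ h₃ hA) (wmOfInput W) (thetaOf _ (thetaClassInputOf _ X)) (d12Of μ) (d34Of μ)).Gen12FunBridge V c))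
    (real34 : ∀ {L : CMField} {ι₁ : L →+* ℂ} (V : HermSpace3 L ι₁) (c : SeesawCtx L),
      (thetaModelOf hHD hI h₁ h₃ h (embOf hHD hI h₁ h₃) (coverOf hHD hI h₁ h₃ hA) (wmOfInput W) (thetaOf _ (thetaClassInputOf _ X)) (d12Of μ) (d34Of μ)).GoodCtx ι₁ c → Module.finrank ℚ c.K = 6 →
      Nonempty ((thetaModelOf hHD hI h₁ h₃ h (embOf hHD hI h₁ h₃) (coverOf hHD hI h₁ h₃ hA) (wmOfInput W) (thetaOf _ (thetaClassInputOf _ X)) (d12Of μ) (d34Of μ)).Real34FunBridge V c))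
    (hyp12 : ∀ {L : CMField} {ι₁ : L →+* ℂ} (V : HermSpace3 L ι₁) (c : SeesawCtx L),
      (thetaModelOf hHD hI h₁ h₃ h (embOf hHD hI h₁ h₃) (coverOf hHD hI h₁ h₃ hA) (wmOfInput W) (thetaOf _ (thetaClassInputOf _ X)) (d12Of μ) (d34Of μ)).GoodCtx ι₁ c → Module.finrank ℚ c.K = 6 →
      Nonempty (((coreOf _ (embOf hHD hI h₁ h₃) (coverOf hHD hI h₁ h₃ hA) (wmOfInput W) (thetaOf _ (thetaClassInputOf _ X))).toCore h).HypSmoothCore12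
        (((coreOf _ (embOf hHD hI h₁ h₃) (coverOf hHD hI h₁ h₃ hA) (wmOfInput W) (thetaOf _ (thetaClassInputOf _ X))).toCore h).side12 (d12Of μ)) (((coreOf _ (embOf hHD hI h₁ h₃) (coverOf hHD hI h₁ h₃ hA) (wmOfInput W) (thetaOf _ (thetaClassInputOf _ X))).toCore h).side34 (d34Of μ))
        ((((coreOf _ (embOf hHD hI h₁ h₃) (coverOf hHD hI h₁ h₃ hA) (wmOfInput W) (thetaOf _ (thetaClassInputOf _ X))).toCore h).analyticKM (((coreOf _ (embOf hHD hI h₁ h₃) (coverOf hHD hI h₁ h₃ hA) (wmOfInput W) (thetaOf _ (thetaClassInputOf _ X))).toCore h).side12 (d12Of μ))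
          (((coreOf _ (embOf hHD hI h₁ h₃) (coverOf hHD hI h₁ h₃ hA) (wmOfInput W) (thetaOf _ (thetaClassInputOf _ X))).toCore h).side34 (d34Of μ))).toAnalytic) V c (ℓ := linOfInput W V c)))
    (hyp34 : ∀ {L : CMField} {ι₁ : L →+* ℂ} (V : HermSpace3 L ι₁) (c : SeesawCtx L),
      (thetaModelOf hHD hI h₁ h₃ h (embOf hHD hI h₁ h₃) (coverOf hHD hI h₁ h₃ hA) (wmOfInput W) (thetaOf _ (thetaClassInputOf _ X)) (d12Of μ) (d34Of μ)).GoodCtx ι₁ c → Module.finrank ℚ c.K = 6 →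
      Nonempty (((coreOf _ (embOf hHD hI h₁ h₃) (coverOf hHD hI h₁ h₃ hA) (wmOfInput W) (thetaOf _ (thetaClassInputOf _ X))).toCore h).HypSmoothCore34
        (((coreOf _ (embOf hHD hI h₁ h₃) (coverOf hHD hI h₁ h₃ hA) (wmOfInput W) (thetaOf _ (thetaClassInputOf _ X))).toCore h).side12 (d12Of μ)) (((coreOf _ (embOf hHD hI h₁ h₃) (coverOf hHD hI h₁ h₃ hA) (wmOfInput W) (thetaOf _ (thetaClassInputOf _ X))).toCore h).side34 (d34Of μ))
        ((((coreOf _ (embOf hHD hI h₁ h₃) (coverOf hHD hI h₁ h₃ hA) (wmOfInput W) (thetaOf _ (thetaClassInputOf _ X))).toCore h).analyticKM (((coreOf _ (embOf hHD hI h₁ h₃) (coverOf hHD hI h₁ h₃ hA) (wmOfInput W) (thetaOf _ (thetaClassInputOf _ X))).toCore h).side12 (d12Of μ))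
          (((coreOf _ (embOf hHD hI h₁ h₃) (coverOf hHD hI h₁ h₃ hA) (wmOfInput W) (thetaOf _ (thetaClassInputOf _ X))).toCore h).side34 (d34Of μ))).toAnalytic) V c (ℓ := linOfInput W V c))) :
    (picardCMUniverse hHD hI h₁ h₃).PerL :=
  perL_picardCM_r8core hHD hI h₁ h₃ hHR h hA W X μ hBetti (fact_cmInflation_riemann hHD hI h₃ h₁ hR)
    hLiu thetaSat transl A gen12 real34 hyp12 hyp34

/-- **E2 instance, revision 8 (Shimura headline)**: the core at
`h31 := Model.fact_cmInflation_printed hHD hI h₃ h₁ hd ha` (mc-axioms-1-g3, revision 5's route), binders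
`hd : Shimura1998_Thm3_isogenousPower`, `ha : Shimura1998_Thm2_Cor`. -/
theorem perL_picardCM_r8s (hHR : BettiUniverse.HodgeRiemann20) (h : Bool)
    (hA : Arapura2012_Cor_15_4_6)
    (W : ∀ {L : CMField} {ι₁ : L →+* ℂ} (V : HermSpace3 L ι₁) (c : SeesawCtx L), WmInput V c.D)
    (X : ∀ {L : CMField} {ι₁ : L →+* ℂ} (V : HermSpace3 L ι₁) (c : SeesawCtx L),
      ThetaSpaceInput (picardCMUniverse hHD hI h₁ h₃) V c)
    (μ : ∀ {L : CMField}, SeesawCtx L → Fin 4 → NumberField.InfinitePlace L → ℤ)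
    (hBetti : ∀ {L : CMField} {ι₁ : L →+* ℂ} (V : HermSpace3 L ι₁), EmbBettiSide hHD hI h₁ h₃ V)
    (hd : Shimura1998_Thm3_isogenousPower) (ha : Shimura1998_Thm2_Cor)
    (hLiu : ∀ {L : CMField} {ι₁ : L →+* ℂ} (V : HermSpace3 L ι₁) (c : SeesawCtx L),
      (thetaModelOf hHD hI h₁ h₃ h (embOf hHD hI h₁ h₃) (coverOf hHD hI h₁ h₃ hA) (wmOfInput W) (thetaOf _ (thetaClassInputOf _ X)) (d12Of μ) (d34Of μ)).GoodCtx ι₁ c → Module.finrank ℚ c.K = 6 →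
      ∀ (i : Fin 4) (Γ : Level V), ∃ (M : CMField) (k : c.K →+* M) (σ' : M →+* ℂ), σ'.comp k = c.σ ∧
        (thetaModelOf hHD hI h₁ h₃ h (embOf hHD hI h₁ h₃) (coverOf hHD hI h₁ h₃ hA) (wmOfInput W) (thetaOf _ (thetaClassInputOf _ X)) (d12Of μ) (d34Of μ)).Theta V c i Γ ⊆
          (picardCMUniverse hHD hI h₁ h₃).Uiso Γ M (inflate k (c.Ψ i)) σ')
    (thetaSat : ∀ {L : CMField} {ι₁ : L →+* ℂ} (V : HermSpace3 L ι₁) (c : SeesawCtx L)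
      (i : Fin 4) (Γ Γ' : Level V) (hle : Γ' ≤ Γ) (ω : (picardCMUniverse hHD hI h₁ h₃).CohC ((picardCMUniverse hHD hI h₁ h₃).pms L ι₁ V Γ) 1),
      ω ∈ (thetaModelOf hHD hI h₁ h₃ h (embOf hHD hI h₁ h₃) (coverOf hHD hI h₁ h₃ hA) (wmOfInput W) (thetaOf _ (thetaClassInputOf _ X)) (d12Of μ) (d34Of μ)).Theta V c i Γ →
        (picardCMUniverse hHD hI h₁ h₃).pullC (coverOf hHD hI h₁ h₃ hA Γ Γ' (Level.Γ_mono hle)) 1 ω ∈ (thetaModelOf hHD hI h₁ h₃ h (embOf hHD hI h₁ h₃) (coverOf hHD hI h₁ h₃ hA) (wmOfInput W) (thetaOf _ (thetaClassInputOf _ X)) (d12Of μ) (d34Of μ)).Theta V c i Γ')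
    (transl : ∀ {L : CMField} {ι₁ : L →+* ℂ} (V : HermSpace3 L ι₁) (c : SeesawCtx L)
      (hc : (thetaModelOf hHD hI h₁ h₃ h (embOf hHD hI h₁ h₃) (coverOf hHD hI h₁ h₃ hA) (wmOfInput W) (thetaOf _ (thetaClassInputOf _ X)) (d12Of μ) (d34Of μ)).GoodCtx ι₁ c) (hK : Module.finrank ℚ c.K = 6),
      ∀ γ ∈ (ballOf hHD hI h₁ h₃ V c (two_lt_finrank_of_goodCtx hHD hI h₁ h₃ hc hK)).Δ, ∀ (i : Fin 4) (Γ : Level V) (ω : (picardCMUniverse hHD hI h₁ h₃).CohC ((picardCMUniverse hHD hI h₁ h₃).pms L ι₁ V Γ) 1),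
      ω ∈ (thetaModelOf hHD hI h₁ h₃ h (embOf hHD hI h₁ h₃) (coverOf hHD hI h₁ h₃ hA) (wmOfInput W) (thetaOf _ (thetaClassInputOf _ X)) (d12Of μ) (d34Of μ)).Theta V c i Γ → ∃ (Γ' : Level V) (ω' : (picardCMUniverse hHD hI h₁ h₃).CohC ((picardCMUniverse hHD hI h₁ h₃).pms L ι₁ V Γ') 1),
        ω' ∈ (thetaModelOf hHD hI h₁ h₃ h (embOf hHD hI h₁ h₃) (coverOf hHD hI h₁ h₃ hA) (wmOfInput W) (thetaOf _ (thetaClassInputOf _ X)) (d12Of μ) (d34Of μ)).Theta V c i Γ' ∧ (ballOf hHD hI h₁ h₃ V c (two_lt_finrank_of_goodCtx hHD hI h₁ h₃ hc hK)).ev Γ' ω' =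
          fun x => (ballOf hHD hI h₁ h₃ V c (two_lt_finrank_of_goodCtx hHD hI h₁ h₃ hc hK)).J γ x *ᵥ (ballOf hHD hI h₁ h₃ V c (two_lt_finrank_of_goodCtx hHD hI h₁ h₃ hc hK)).ev Γ ω (γ • x))
    (A : ∀ {L : CMField} {ι₁ : L →+* ℂ} (V : HermSpace3 L ι₁) (c : SeesawCtx L),
      (thetaModelOf hHD hI h₁ h₃ h (embOf hHD hI h₁ h₃) (coverOf hHD hI h₁ h₃ hA) (wmOfInput W) (thetaOf _ (thetaClassInputOf _ X)) (d12Of μ) (d34Of μ)).GoodCtx ι₁ c → Module.finrank ℚ c.K = 6 →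
        ∀ k : Fin 4, k = 0 ∨ k = 1 → ∀ N : ℕ, 0 < N → SupplySituationAt (X V c) k N)
    (gen12 : ∀ {L : CMField} {ι₁ : L →+* ℂ} (V : HermSpace3 L ι₁) (c : SeesawCtx L),
      (thetaModelOf hHD hI h₁ h₃ h (embOf hHD hI h₁ h₃) (coverOf hHD hI h₁ h₃ hA) (wmOfInput W) (thetaOf _ (thetaClassInputOf _ X)) (d12Of μ) (d34Of μ)).GoodCtx ι₁ c → Module.finrank ℚ c.K = 6 →
      Nonempty ((thetaModelOf hHD hI h₁ h₃ h (embOf hHD hI h₁ h₃) (coverOf hHD hI h₁ h₃ hA) (wmOfInput W) (thetaOf _ (thetaClassInputOf _ X)) (d12Of μ) (d34Of μ)).Gen12FunBridge V c))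
    (real34 : ∀ {L : CMField} {ι₁ : L →+* ℂ} (V : HermSpace3 L ι₁) (c : SeesawCtx L),
      (thetaModelOf hHD hI h₁ h₃ h (embOf hHD hI h₁ h₃) (coverOf hHD hI h₁ h₃ hA) (wmOfInput W) (thetaOf _ (thetaClassInputOf _ X)) (d12Of μ) (d34Of μ)).GoodCtx ι₁ c → Module.finrank ℚ c.K = 6 →
      Nonempty ((thetaModelOf hHD hI h₁ h₃ h (embOf hHD hI h₁ h₃) (coverOf hHD hI h₁ h₃ hA) (wmOfInput W) (thetaOf _ (thetaClassInputOf _ X)) (d12Of μ) (d34Of μ)).Real34FunBridge V c))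
    (hyp12 : ∀ {L : CMField} {ι₁ : L →+* ℂ} (V : HermSpace3 L ι₁) (c : SeesawCtx L),
      (thetaModelOf hHD hI h₁ h₃ h (embOf hHD hI h₁ h₃) (coverOf hHD hI h₁ h₃ hA) (wmOfInput W) (thetaOf _ (thetaClassInputOf _ X)) (d12Of μ) (d34Of μ)).GoodCtx ι₁ c → Module.finrank ℚ c.K = 6 →
      Nonempty (((coreOf _ (embOf hHD hI h₁ h₃) (coverOf hHD hI h₁ h₃ hA) (wmOfInput W) (thetaOf _ (thetaClassInputOf _ X))).toCore h).HypSmoothCore12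
        (((coreOf _ (embOf hHD hI h₁ h₃) (coverOf hHD hI h₁ h₃ hA) (wmOfInput W) (thetaOf _ (thetaClassInputOf _ X))).toCore h).side12 (d12Of μ)) (((coreOf _ (embOf hHD hI h₁ h₃) (coverOf hHD hI h₁ h₃ hA) (wmOfInput W) (thetaOf _ (thetaClassInputOf _ X))).toCore h).side34 (d34Of μ))
        ((((coreOf _ (embOf hHD hI h₁ h₃) (coverOf hHD hI h₁ h₃ hA) (wmOfInput W) (thetaOf _ (thetaClassInputOf _ X))).toCore h).analyticKM (((coreOf _ (embOf hHD hI h₁ h₃) (coverOf hHD hI h₁ h₃ hA) (wmOfInput W) (thetaOf _ (thetaClassInputOf _ X))).toCore h).side12 (d12Of μ))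
          (((coreOf _ (embOf hHD hI h₁ h₃) (coverOf hHD hI h₁ h₃ hA) (wmOfInput W) (thetaOf _ (thetaClassInputOf _ X))).toCore h).side34 (d34Of μ))).toAnalytic) V c (ℓ := linOfInput W V c)))
    (hyp34 : ∀ {L : CMField} {ι₁ : L →+* ℂ} (V : HermSpace3 L ι₁) (c : SeesawCtx L),
      (thetaModelOf hHD hI h₁ h₃ h (embOf hHD hI h₁ h₃) (coverOf hHD hI h₁ h₃ hA) (wmOfInput W) (thetaOf _ (thetaClassInputOf _ X)) (d12Of μ) (d34Of μ)).GoodCtx ι₁ c → Module.finrank ℚ c.K = 6 →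
      Nonempty (((coreOf _ (embOf hHD hI h₁ h₃) (coverOf hHD hI h₁ h₃ hA) (wmOfInput W) (thetaOf _ (thetaClassInputOf _ X))).toCore h).HypSmoothCore34
        (((coreOf _ (embOf hHD hI h₁ h₃) (coverOf hHD hI h₁ h₃ hA) (wmOfInput W) (thetaOf _ (thetaClassInputOf _ X))).toCore h).side12 (d12Of μ)) (((coreOf _ (embOf hHD hI h₁ h₃) (coverOf hHD hI h₁ h₃ hA) (wmOfInput W) (thetaOf _ (thetaClassInputOf _ X))).toCore h).side34 (d34Of μ))
        ((((coreOf _ (embOf hHD hI h₁ h₃) (coverOf hHD hI h₁ h₃ hA) (wmOfInput W) (thetaOf _ (thetaClassInputOf _ X))).toCore h).analyticKM (((coreOf _ (embOf hHD hI h₁ h₃) (coverOf hHD hI h₁ h₃ hA) (wmOfInput W) (thetaOf _ (thetaClassInputOf _ X))).toCore h).side12 (d12Of μ))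
          (((coreOf _ (embOf hHD hI h₁ h₃) (coverOf hHD hI h₁ h₃ hA) (wmOfInput W) (thetaOf _ (thetaClassInputOf _ X))).toCore h).side34 (d34Of μ))).toAnalytic) V c (ℓ := linOfInput W V c))) :
    (picardCMUniverse hHD hI h₁ h₃).PerL :=
  perL_picardCM_r8core hHD hI h₁ h₃ hHR h hA W X μ hBetti (fact_cmInflation_printed hHD hI h₃ h₁ hd ha)
    hLiu thetaSat transl A gen12 real34 hyp12 hyp34

end Model

end HodgeCM

end
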